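import Summits.Langlands.Langlands.Theses.PrimeSwitchSplit
import Summits.Langlands.Langlands.Theorems.IrreducibilityBySelfDualityReciprocityUpToIrreducibilityCorrespondsConj
import Literature.NumberTheory.Automorphic.LocalComponentBJUniqueProofs
import Literature.NumberTheory.GaloisRepresentations.WeilDeligneOfGaloisProofs
import Literature.NumberTheory.GaloisRepresentations.WeilDeligneRepFrobSemisimpleProofs

/-! # Crux attack at birth — stmt-Langlands-18084 `PrimeSwitchSplit.CompatibilityAwayFromLR` (Scratch)
S1 cheap closers · S2 hypothesis mutation (irreducibility redundant mod W⁺; `0 < n` guard idle;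
geometric hypothesis idle in S → C) · S3 the ∀Rec layer = one datum + rigidity on local components ·
S4 TIGHTNESS: C forces datum rigidity on local components of avatar-bearing π (the "Henniart exposure"
made precise) -/

open scoped MatrixGroups NumberField
open IsDedekindDomain Filter
open Literature.NumberTheory.Automorphic Literature.NumberTheory.GaloisRepresentations
open Summit.Langlands Summit.Langlands.Langlands.Theses.PrimeSwitchSplit
open Summit.Langlands.Langlands.Theorems

namespace CruxAttack18084

/-! ## S1 cheap closers do not fire -/

example : CompatibilityAwayFromLR := by
  fail_if_success (simp [CompatibilityAwayFromLR]; done)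
  fail_if_success (aesop (config := { terminal := true }))
  fail_if_success (intro K _ _ Rec n hcpt hn π hL ℓ _ ι ρ hirr hgeo hρ v hv; simp_all; done)
  sorry

/-! ## S2 hypothesis mutation -/

/-- The body of the crux at ONE datum `Rec` (verbatim). -/
def Body (K : Type) [Field K] [NumberField K] (Rec : ReciprocityData K) : Prop :=
  ∀ (n : ℕ) (hcpt : isCompact_glFiniteIntegralLevel n K), 0 < n →
    ∀ (π : CuspidalAutomorphicRepData n K hcpt), π.1.IsLAlgebraic →
    ∀ (ℓ : ℕ) [Fact ℓ.Prime] (ι : PadicAlgCl ℓ ≃+* ℂ) (ρ : FramedGaloisRep K (PadicAlgCl ℓ) n),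
      ρ.toGaloisRep.IsIrreducible →
      ((∀ᶠ v : HeightOneSpectrum (𝓞 K) in cofinite, ρ.IsUnramifiedAt v) ∧
        ∀ (v : HeightOneSpectrum (𝓞 K)) (hv : ((ℓ : ℕ) : 𝓞 K) ∈ v.asIdeal),
          (Literature.NumberTheory.PAdicHodge.fontainePstAdicCompletion v ℓ hv).IsDeRhamFramed (ρ.toLocal v)) →
      (∀ᶠ v : HeightOneSpectrum (𝓞 K) in cofinite, SatakeFrobCompatibleAt ι π.1 ρ v) →
      ∀ v : HeightOneSpectrum (𝓞 K), ((ℓ : ℕ) : 𝓞 K) ∉ v.asIdeal → LocalGlobalCompatibleAt Rec ι π.1 ρ v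

theorem crux_iff_body : CompatibilityAwayFromLR ↔
    ∀ (K : Type) [Field K] [NumberField K] (Rec : ReciprocityData K), Body K Rec := Iff.rfl

/-- The crux WITHOUT the irreducibility hypothesis on `ρ`. -/
def NoIrr : Prop :=
  ∀ (K : Type) [Field K] [NumberField K] (Rec : ReciprocityData K) (n : ℕ)
    (hcpt : isCompact_glFiniteIntegralLevel n K), 0 < n →
    ∀ (π : CuspidalAutomorphicRepData n K hcpt), π.1.IsLAlgebraic →
    ∀ (ℓ : ℕ) [Fact ℓ.Prime] (ι : PadicAlgCl ℓ ≃+* ℂ) (ρ : FramedGaloisRep K (PadicAlgCl ℓ) n),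
      ((∀ᶠ v : HeightOneSpectrum (𝓞 K) in cofinite, ρ.IsUnramifiedAt v) ∧
        ∀ (v : HeightOneSpectrum (𝓞 K)) (hv : ((ℓ : ℕ) : 𝓞 K) ∈ v.asIdeal),
          (Literature.NumberTheory.PAdicHodge.fontainePstAdicCompletion v ℓ hv).IsDeRhamFramed (ρ.toLocal v)) →
      (∀ᶠ v : HeightOneSpectrum (𝓞 K) in cofinite, SatakeFrobCompatibleAt ι π.1 ρ v) →
      ∀ v : HeightOneSpectrum (𝓞 K), ((ℓ : ℕ) : 𝓞 K) ∉ v.asIdeal → LocalGlobalCompatibleAt Rec ι π.1 ρ v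

/-- S2a: modulo the sibling crux W⁺ (`SatakeAvatarExistence`, stmt-Langlands-17415) the irreducibility
hypothesis is REDUNDANT — any `ρ` Satake-compatible a.e. with a `π` that has an irreducible avatar is
irreducible (Chebotarev + Brauer–Nesbitt, landed `IrreducibleOffSector.isIrreducible_of_satakeFrobCompatible`). -/
theorem noIrr_of_satakeAvatarExistence (hW : SatakeAvatarExistence) (hC : CompatibilityAwayFromLR) :
    NoIrr := by
  intro K _ _ Rec n hcpt hn π hL ℓ _ ι ρ hgeo hρ v hv
  obtain ⟨ρ₀, hirr₀, hρ₀⟩ := hW K n hcpt hn π hL ℓ ι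
  exact hC K Rec n hcpt hn π hL ℓ ι ρ
    (IrreducibleOffSector.isIrreducible_of_satakeFrobCompatible π.1 ι hirr₀ hρ₀ hρ) hgeo hρ v hv

theorem of_noIrr (h : NoIrr) : CompatibilityAwayFromLR :=
  fun K _ _ Rec n hcpt hn π hL ℓ _ ι ρ _ hgeo hρ v hv => h K Rec n hcpt hn π hL ℓ ι ρ hgeo hρ v hv

/-- The crux WITHOUT the guard `0 < n`. -/
def NoGuard : Prop :=
  ∀ (K : Type) [Field K] [NumberField K] (Rec : ReciprocityData K) (n : ℕ)
    (hcpt : isCompact_glFiniteIntegralLevel n K)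
    (π : CuspidalAutomorphicRepData n K hcpt), π.1.IsLAlgebraic →
    ∀ (ℓ : ℕ) [Fact ℓ.Prime] (ι : PadicAlgCl ℓ ≃+* ℂ) (ρ : FramedGaloisRep K (PadicAlgCl ℓ) n),
      ρ.toGaloisRep.IsIrreducible →
      ((∀ᶠ v : HeightOneSpectrum (𝓞 K) in cofinite, ρ.IsUnramifiedAt v) ∧
        ∀ (v : HeightOneSpectrum (𝓞 K)) (hv : ((ℓ : ℕ) : 𝓞 K) ∈ v.asIdeal),
          (Literature.NumberTheory.PAdicHodge.fontainePstAdicCompletion v ℓ hv).IsDeRhamFramed (ρ.toLocal v)) →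
      (∀ᶠ v : HeightOneSpectrum (𝓞 K) in cofinite, SatakeFrobCompatibleAt ι π.1 ρ v) →
      ∀ v : HeightOneSpectrum (𝓞 K), ((ℓ : ℕ) : 𝓞 K) ∉ v.asIdeal → LocalGlobalCompatibleAt Rec ι π.1 ρ v

/-- S2b: the guard `0 < n` is IDLE — in rank `0` no framed representation is irreducible (the zero space
has one subrepresentation), so the guarded and unguarded forms are equivalent. -/
theorem noGuard_iff : NoGuard ↔ CompatibilityAwayFromLR := by
  constructor
  · exact fun h K _ _ Rec n hcpt _ π hL ℓ _ ι ρ hirr hgeo hρ v hv => h K Rec n hcpt π hL ℓ ι ρ hirr hgeo hρ v hv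
  · intro h K _ _ Rec n hcpt π hL ℓ _ ι ρ hirr hgeo hρ v hv
    rcases Nat.eq_zero_or_pos n with rfl | hn
    · exfalso
      obtain ⟨W₁, W₂, hne⟩ := hirr.toNontrivial
      exact hne (Subrepresentation.toSubmodule_injective (Subsingleton.elim _ _))
    · exact h K Rec n hcpt hn π hL ℓ ι ρ hirr hgeo hρ v hv

/-! ## S3 the `∀ Rec` layer: one datum + rigidity on local components -/

/-- Local–global compatibility at `v` transfers across data agreeing on the class of the local component
(re-proved inline; = the ideator's `localGlobalCompatibleAt_of_recGL_eq`). -/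
theorem localGlobalCompatibleAt_transfer {K : Type} [Field K] [NumberField K]
    (Rec Rec' : ReciprocityData K) {n : ℕ} {hcpt : isCompact_glFiniteIntegralLevel n K}
    {ℓ : ℕ} [Fact ℓ.Prime] (ι : PadicAlgCl ℓ ≃+* ℂ)
    (π : CuspidalAutomorphicRepData n K hcpt) (ρ : FramedGaloisRep K (PadicAlgCl ℓ) n)
    (v : HeightOneSpectrum (𝓞 K))
    (hagree : ∀ πv : SmoothIrrep (GL (Fin n) (v.adicCompletion K)), π.1.HasLocalComponentAt v πv.ρ →
      (Rec.llc v).recGL n (IrrClass.mk πv) = (Rec'.llc v).recGL n (IrrClass.mk πv))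
    (h : LocalGlobalCompatibleAt Rec ι π.1 ρ v) : LocalGlobalCompatibleAt Rec' ι π.1 ρ v := by
  obtain ⟨πv, r, rℂ, hloc, haway, habove, htrans, hclass⟩ := h
  refine ⟨πv, r, rℂ, hloc, haway, habove, htrans, ?_⟩
  rw [← hagree πv hloc]
  exact hclass

/-- Rigidity of pinned reciprocity data on local components of L-algebraic cuspidal `π` — the
conclusion of the LANDED `stub_recRigidityLAlg_of_genericRigidity ∘ stub_genericRigidity_of_facts`
(Theorems/…RRigidityGlue, …RGenericRigidityOfFacts: from the printed local facts h1–h5). -/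
def RigidityOnLocalComponents : Prop :=
  ∀ (K : Type) [Field K] [NumberField K] (Rec Rec' : ReciprocityData K) (n : ℕ)
    (hcpt : isCompact_glFiniteIntegralLevel n K), 0 < n →
    ∀ (π : CuspidalAutomorphicRepData n K hcpt), π.1.IsLAlgebraic →
      ∀ (v : HeightOneSpectrum (𝓞 K)) (πv : SmoothIrrep (GL (Fin n) (v.adicCompletion K))),
        π.1.HasLocalComponentAt v πv.ρ →
          (Rec.llc v).recGL n (IrrClass.mk πv) = (Rec'.llc v).recGL n (IrrClass.mk πv)

/-- S3a: under rigidity the body is datum-independent, so `∀ Rec` (L∤R) = "at any one datum per field". -/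
theorem body_transfer (hrig : RigidityOnLocalComponents) {K : Type} [Field K] [NumberField K]
    (Rec Rec' : ReciprocityData K) (h : Body K Rec) : Body K Rec' := by
  intro n hcpt hn π hL ℓ _ ι ρ hirr hgeo hρ v hv
  exact localGlobalCompatibleAt_transfer Rec Rec' ι π ρ v
    (fun πv hπv => hrig K Rec Rec' n hcpt hn π hL v πv hπv) (h n hcpt hn π hL ℓ ι ρ hirr hgeo hρ v hv)

/-- S3b: hence, under rigidity, the `∀ Rec` crux follows from the `∃ Rec` form (old L∤, stmt-17417 shape). -/
theorem crux_of_exists_form (hrig : RigidityOnLocalComponents)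
    (hE : ∀ (K : Type) [Field K] [NumberField K], Nonempty (ReciprocityData K) → ∃ Rec : ReciprocityData K, Body K Rec) :
    CompatibilityAwayFromLR := by
  intro K _ _ Rec
  obtain ⟨Rec₀, h₀⟩ := hE K ⟨Rec⟩
  exact body_transfer hrig Rec₀ Rec h₀


/-! ## S4° two inlined invariance lemmas (verbatim from Theorems/…RTightness, whose olean is not served this window) -/

section WD

variable {F : Type} [Field F] [ValuativeRel F] [TopologicalSpace F] [IsNonarchimedeanLocalField F]
  {n : ℕ}

/-- Isomorphic `E`-linear Weil–Deligne representations have complex transports with ONE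
Frobenius-semisimple class (copied from `ReciprocityUpToIrreducibilityR.frobSemisimpleClass_eq_of_isEquivalent_of_isTransportAlong`). -/
theorem frobSemisimpleClass_eq_of_isEquivalent_of_isTransportAlong {E : Type*} [Field E] [CharZero E]
    (ι : E →+* ℂ) {r r' : WeilDeligneRep F E (Fin n → E)} {s s' : WeilDeligneRep F ℂ (Fin n → ℂ)}
    (h : r.IsEquivalent r') (hs : r.IsTransportAlong ι s) (hs' : r'.IsTransportAlong ι s')
    {c c' : Quotient (frobSemisimpleWDSetoid F n)} (hc : s.HasFrobSemisimpleClass c)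
    (hc' : s'.HasFrobSemisimpleClass c') : c = c' := by
  have hss' : s.IsEquivalent s' := by
    obtain ⟨eqv⟩ := h
    set e : (Fin n → E) ≃ₗ[E] (Fin n → E) := eqv.toRepEquiv.toLinearEquiv with he
    set M : Matrix (Fin n) (Fin n) E := LinearMap.toMatrix' (e : (Fin n → E) →ₗ[E] (Fin n → E))
    set M' : Matrix (Fin n) (Fin n) E :=
      LinearMap.toMatrix' (e.symm : (Fin n → E) →ₗ[E] (Fin n → E))
    have hMM' : M * M' = 1 := by
      rw [← LinearMap.toMatrix'_comp, LinearEquiv.comp_symm, LinearMap.toMatrix'_id]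
    have hM'M : M' * M = 1 := by
      rw [← LinearMap.toMatrix'_comp, LinearEquiv.symm_comp, LinearMap.toMatrix'_id]
    have hρ : ∀ w, M * LinearMap.toMatrix' (r.ρ w) = LinearMap.toMatrix' (r'.ρ w) * M := fun w => by
      rw [← LinearMap.toMatrix'_comp, ← LinearMap.toMatrix'_comp]
      exact congrArg LinearMap.toMatrix' (eqv.toRepEquiv.toIntertwiningMap.isIntertwining' w)
    have hN : M * LinearMap.toMatrix' r.N = LinearMap.toMatrix' r'.N * M := by
      rw [← LinearMap.toMatrix'_comp, ← LinearMap.toMatrix'_comp]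
      exact congrArg LinearMap.toMatrix' eqv.comm_N
    have h1 : M'.map ι * M.map ι = 1 := by
      rw [← Matrix.map_mul, hM'M, Matrix.map_one _ ι.map_zero ι.map_one]
    have h2 : M.map ι * M'.map ι = 1 := by
      rw [← Matrix.map_mul, hMM', Matrix.map_one _ ι.map_zero ι.map_one]
    let e' : (Fin n → ℂ) ≃ₗ[ℂ] (Fin n → ℂ) := Matrix.toLin'OfInv h1 h2
    have he' : (e' : (Fin n → ℂ) →ₗ[ℂ] (Fin n → ℂ)) = Matrix.toLin' (M.map ι) :=
      LinearMap.ext fun _ => rfl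
    have hint : ∀ w, (e' : (Fin n → ℂ) →ₗ[ℂ] (Fin n → ℂ)) ∘ₗ s.ρ w =
        s'.ρ w ∘ₗ (e' : (Fin n → ℂ) →ₗ[ℂ] (Fin n → ℂ)) := fun w => by
      refine LinearMap.toMatrix'.injective ?_
      rw [LinearMap.toMatrix'_comp, LinearMap.toMatrix'_comp, he', LinearMap.toMatrix'_toLin',
        hs.1 w, hs'.1 w, ← Matrix.map_mul, hρ w, Matrix.map_mul]
    have hintN : (e' : (Fin n → ℂ) →ₗ[ℂ] (Fin n → ℂ)) ∘ₗ s.N =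
        s'.N ∘ₗ (e' : (Fin n → ℂ) →ₗ[ℂ] (Fin n → ℂ)) := by
      refine LinearMap.toMatrix'.injective ?_
      rw [LinearMap.toMatrix'_comp, LinearMap.toMatrix'_comp, he', LinearMap.toMatrix'_toLin',
        hs.2, hs'.2, ← Matrix.map_mul, hN, Matrix.map_mul]
    exact ⟨{ toRepEquiv := Representation.Equiv.mk e' hint, comm_N := hintN }⟩
  obtain ⟨t, ht, rfl⟩ := ReciprocityUpToIrreducibility.hasFrobSemisimpleClass_of_isEquivalent hss' hc
  obtain ⟨t', ht', rfl⟩ := hc'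
  obtain rfl : t = t' :=
    (WeilDeligneRep.existsUnique_frobSemisimplification_holds (C := ℂ) (V := Fin n → ℂ) s').unique
      ht ht'
  rfl

end WD

/-- Two reciprocity data both locally–globally compatible (away from `ℓ'`) with ONE pair `(π, ρ₁)` at
`v` agree on the local component of `π` at `v` (copied from
`ReciprocityUpToIrreducibilityR.recGL_eq_of_localGlobalCompatibleAtR`). -/
theorem recGL_eq_of_localGlobalCompatibleAtR {K : Type} [Field K] [NumberField K] {n : ℕ}
    {hcpt : isCompact_glFiniteIntegralLevel n K} (Rec Rec₀ : ReciprocityData K) {ℓ' : ℕ} [Fact ℓ'.Prime]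
    (ι' : PadicAlgCl ℓ' ≃+* ℂ) (π : CuspidalAutomorphicRepData n K hcpt)
    (ρ₁ : FramedGaloisRep K (PadicAlgCl ℓ') n) {v : HeightOneSpectrum (𝓞 K)}
    (hv : ((ℓ' : ℕ) : 𝓞 K) ∉ v.asIdeal) (h : LocalGlobalCompatibleAt Rec ι' π.1 ρ₁ v)
    (h₀ : LocalGlobalCompatibleAt Rec₀ ι' π.1 ρ₁ v)
    (πv : SmoothIrrep (GL (Fin n) (v.adicCompletion K))) (hπv : π.1.HasLocalComponentAt v πv.ρ) :
    (Rec.llc v).recGL n (IrrClass.mk πv) = (Rec₀.llc v).recGL n (IrrClass.mk πv) := by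
  obtain ⟨πv₁, r₁, rℂ₁, hπv₁, hlad₁, -, htr₁, hcls₁⟩ := h
  obtain ⟨πv₂, r₂, rℂ₂, hπv₂, hlad₂, -, htr₂, hcls₂⟩ := h₀
  have e₁ : IrrClass.mk πv₁ = IrrClass.mk πv :=
    AutomorphicRepData.hasLocalComponentAt_unique_holds π.1 v πv₁ πv hπv₁ hπv
  have e₂ : IrrClass.mk πv₂ = IrrClass.mk πv :=
    AutomorphicRepData.hasLocalComponentAt_unique_holds π.1 v πv₂ πv hπv₂ hπv
  rw [e₁] at hcls₁
  rw [e₂] at hcls₂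
  have hr : r₁.IsEquivalent r₂ :=
    IsWeilDeligneOfLadic.isEquivalent_holds _ r₁ r₂ (hlad₁ hv) (hlad₂ hv)
  exact frobSemisimpleClass_eq_of_isEquivalent_of_isTransportAlong _ hr htr₁ htr₂ hcls₁ hcls₂

/-! ## S4 TIGHTNESS — the converse: the crux forces rigidity on avatar-bearing local components -/

/-- S4: `CompatibilityAwayFromLR` forces any two pinned reciprocity data to AGREE on the local
component at `v` of every L-algebraic cuspidal `π` that carries, for some prime `ℓ` below which `v`
does not lie, an irreducible pinned-geometric `ℓ`-adic avatar Satake-compatible a.e.  (So a refutation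
of the crux "by a legal datum off at a ramified generic class" must exhibit such a `π`; and conversely
generic rigidity — landed modulo printed local facts — discharges the whole `∀ Rec` layer, S3.) -/
theorem rigid_of_crux (hC : CompatibilityAwayFromLR) (K : Type) [Field K] [NumberField K]
    (Rec Rec' : ReciprocityData K) (n : ℕ) (hcpt : isCompact_glFiniteIntegralLevel n K) (hn : 0 < n)
    (π : CuspidalAutomorphicRepData n K hcpt) (hL : π.1.IsLAlgebraic)
    (ℓ : ℕ) [Fact ℓ.Prime] (ι : PadicAlgCl ℓ ≃+* ℂ) (ρ : FramedGaloisRep K (PadicAlgCl ℓ) n)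
    (hirr : ρ.toGaloisRep.IsIrreducible)
    (hgeo : (∀ᶠ v : HeightOneSpectrum (𝓞 K) in cofinite, ρ.IsUnramifiedAt v) ∧
      ∀ (v : HeightOneSpectrum (𝓞 K)) (hv : ((ℓ : ℕ) : 𝓞 K) ∈ v.asIdeal),
        (Literature.NumberTheory.PAdicHodge.fontainePstAdicCompletion v ℓ hv).IsDeRhamFramed (ρ.toLocal v))
    (hρ : ∀ᶠ v : HeightOneSpectrum (𝓞 K) in cofinite, SatakeFrobCompatibleAt ι π.1 ρ v)
    (v : HeightOneSpectrum (𝓞 K)) (hv : ((ℓ : ℕ) : 𝓞 K) ∉ v.asIdeal)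
    (πv : SmoothIrrep (GL (Fin n) (v.adicCompletion K))) (hπv : π.1.HasLocalComponentAt v πv.ρ) :
    (Rec.llc v).recGL n (IrrClass.mk πv) = (Rec'.llc v).recGL n (IrrClass.mk πv) :=
  recGL_eq_of_localGlobalCompatibleAtR Rec Rec' ι π ρ hv
    (hC K Rec n hcpt hn π hL ℓ ι ρ hirr hgeo hρ v hv) (hC K Rec' n hcpt hn π hL ℓ ι ρ hirr hgeo hρ v hv) πv hπv

end CruxAttack18084
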